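import Summits.FinalStateConjecture.FinalStateConjecture.Theses.PhaseMixingCapture
import Summits.FinalStateConjecture.FinalStateConjecture.Theses.SwallowTheDatum
import Summits.FinalStateConjecture.FinalStateConjecture.Theorems.WeakCosmicCensorshipMGHD.Negative.TruncatedMinkowski
import Summits.FinalStateConjecture.FinalStateConjecture.Theorems.KerrShieldedDataExist.Negative.BentHeight
import Literature.Geometry.Lorentzian.StabilityCauchy
import Literature.Geometry.Lorentzian.InitialDataPullback
import Literature.Geometry.Lorentzian.KerrDataProofs
import Literature.Geometry.Lorentzian.KerrSchildCoord

/-!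
# Line `scri-transfer-third-of-burial` — skeleton v2 (lead reshape, 2026-08-16) for the crux
# `PhaseMixingCapture.WeakCosmicCensorshipMGHD` (item stmt-FinalStateConjecture-9952)

Lead prover `prover-line-stmt-FinalStateConjecture-9952-0`, reshape of the planner's skeleton
`Cruxes/WeakCosmicCensorshipMGHD/Lines/scri-transfer-third-of-burial.lean` (round 1, 5 stubs).

## Why the reshape (v1 → v2)

The sibling crux `SwallowTheDatum.KerrShieldedSettles` (stmt-FinalStateConjecture-10054) is being built
RIGHT NOW along the picked line `Cruxes/KerrShieldedSettles/Lines/tapered-temporal-collar.lean`, whose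
registered stubs S1 (`stub_collarCauchy`: the bent leaf is a Cauchy hypersurface of the TAPERED collar
`W = {0 < x⁰ − T(r) + (r − r₁)/4}`) and S4 (`stub_kerrLeafSojourn`: sojourn optics of the exact Kerr chart
seen from the bent leaf) are exactly the two L-sized Kerr cores that v1 had buried inside
`stub_kerrCollarDevelopment` and `stub_kerrFarSojourn`.  v2 registers S1 and S4 VERBATIM (same statement
text, so a proof landed for either crux is imported by the other) and keeps for THIS line only generic /
plumbing stubs:

* `stub_scriTransfer` (THE LEVER, generic, RELATIVE form): far-origin sojourn completeness of ANY data
  embedding `𝒮` of a sub-datum `Φ^*D`, measured against COMPACT SETS OF `X` (reference set `ι'(Φ⁻¹K₀)`,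
  exempted origins `Φ⁻¹K₁`), ascends along an embedding `χ : 𝒮 → 𝒟` over `Φ` to all-origin completeness
  of `𝒟`.  (v1's form with `B₀, B₁` compact in `N` is a corollary; the relative form is what a shield
  needs, since `{r ≤ R₀}` is not compact in the slice but its `φ`-image is co-compactly contained in `X`.)
* `stub_kerrVacuum` (unchanged: the named fact `Kerr.isRicciFlat` under sub-extremality; 10054's S2 is
  the same fact without the hypothesis).
* `stub_collarCauchy` (= 10054 S1 verbatim).
* `stub_collarRealisation` (plumbing adapter): shield + collar-Cauchy + Ricci-flat ⇒ the tapered collar,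
  with the restricted Kerr metric, IS a vacuum Cauchy development `𝒦` of `φ^*D`, realised in the chart by
  `j` (= inclusion) with `taperedCollar ⊆ range j`.
* `stub_kerrLeafSojourn` (= 10054 S4 verbatim; HARDEST, held by the lead).
* `stub_farSojournTransfer` (plumbing adapter): realisation + chart optics ⇒ far-origin sojourn
  completeness of `𝒦` in radius form (maximal `𝒦`-rays are pieces of maximal chart rays through `j`; chart
  rays stay in `{u ≥ 0} ⊆ taperedCollar ⊆ range j` for `t ≥ 0` because `u = x⁰ − T(r)` increases along
  future causal curves).
* `stub_shieldCocompact` (radius form): for an ADMISSIBLE shielded datum every far shield region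
  `φ{R ≤ r}` is co-compact in `X`.

Composition `WeakCosmicCensorshipMGHD_of` (sorry-free): `ParametricKerrBurial` (10052) gives the shielded
members; `MGHDExists` (9937) the `∃`-MGHD conjunct; for a maximal `𝒟`: S1 → adapter R → 𝒦, j; S4 →
adapter F → far completeness of `𝒦`; `stub_shieldCocompact` supplies the compact containers `K₀ ⊇ φ{r ≤
R₀}`, `K₁ᶜ ⊆ φ{R₁ ≤ r}`; `SubdataDevelopmentsEmbed` (10053) gives `χ : 𝒦 → 𝒟` over `φ`; the lever
transfers.  7 stubs (= stubs_max).

## Disproof used (`Cruxes/WeakCosmicCensorshipMGHD/Disproof.lean`, RESISTS; re-read at the reshape)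

No `_false_without_<H>` theorem on the positive line.  §2 (MGHD theory load-bearing): 9937/10053 by
name.  §3: `CompleteNullInfinityInvariant` never owed — and v2's `stub_scriTransfer` with `Φ = id`
PROVES it as a by-product.  §4(b): `[T2Space X]` everywhere.  §4(c)/§8 + `Negative/TruncatedMinkowski`
(imported, re-checked below): completeness never descends; `stub_scriTransfer` ascends, adapter F
certifies a development whose range contains the whole tapered collar (unbounded to the future in the
exterior), never a truncated one.  §7 local families: unused (10052 is global).  §9/§10 burial
loophole: declared on the card; the lever survives re-typing.  Sibling files: 10054 Disproof rev 4
§C1–C2/§H1/§H3 (tapered collar, speed limit, containers in `X`), TRIAGE r1-2 T1/T5 of 10054 (no fixed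
band; `C(M,a)E` ledger) — all honoured by taking S1/S4 verbatim.
-/

set_option linter.dupNamespace false

noncomputable section

namespace Summit.FinalStateConjecture.FinalStateConjecture.Cruxes.WeakCosmicCensorshipMGHD.ScriTransferThirdOfBurial

open scoped Manifold ContDiff Topology
open Set Function Topology Literature.Geometry.Lorentzian
open Summit.FinalStateConjecture.FinalStateConjecture.Theses.PhaseMixingCapture (WeakCosmicCensorshipMGHD)
open Summit.FinalStateConjecture.FinalStateConjecture.Theses.SwallowTheDatum
  (ParametricKerrBurial SubdataDevelopmentsEmbed MGHDExists)
open Summit.FinalStateConjecture.FinalStateConjecture.Theorems.KerrShieldedDataExist.Negative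
  (bentHeight bentHeight_eq_literal)

/-! ## Instances from landed theorems (no hypotheses smuggled: all fields are proved in the tree) -/

/-- `Kerr.Facts` is inhabited: its three fields are theorems (`KerrDataProofs`, `KerrSchildCoord`). -/
instance kerrFacts : Kerr.Facts :=
  ⟨Kerr.isConnected_region_holds, Kerr.contMDiff_bilin_holds, Kerr.contMDiff_timeVector_holds⟩

/-- The Kerr–Schild slices are connected spaces (theorem `Kerr.isConnected_slice_holds`). -/
instance connectedSpace_kerrSlice (a r₀ : ℝ) : ConnectedSpace (Kerr.slice a r₀) :=
  isConnected_iff_connectedSpace.mp (Kerr.isConnected_slice_holds a r₀)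

/-! ## Vocabulary (over existing tree declarations; unfolded verbatim in every landed stub file) -/

section Vocabulary

variable (X : Type) [TopologicalSpace X] [ChartedSpace E3 X] [IsManifold (𝓡 3) ∞ X]

/-- **The shielding predicate of `ParametricKerrBurial` (item 10052) with its witnesses exposed and the
hard-coded height written `bentHeight M a`** (`= T` by `bentHeight_eq_literal : … := rfl`): outside a
compact set `D` is the exact bent Kerr–Schild/Boyer–Lindquist slice `{r > r₁}`, `r₋ < r₁ < r₊`, of the
sub-extremal Kerr `(M, a)`, via the chart `φ`, the graph `ψ` of the bent height and its future unit
normal `ν`.  Every other clause is VERBATIM the body of the existential in 10052's last conjunct. -/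
def IsKerrShieldedBy [Kerr.Facts] (D : InitialDataSet (𝓡 3) X) (M a r₁ : ℝ) (hM : 0 ≤ M)
    (φ : Kerr.slice a r₁ → X) (ψ : Kerr.slice a r₁ → Kerr.region a r₁)
    (ν : NormalField 𝓘(ℝ, E4) ψ) : Prop :=
  |a| < M ∧ Kerr.rMinus M a < r₁ ∧ r₁ < Kerr.rPlus M a ∧
    IsCompact (Set.range φ)ᶜ ∧ Topology.IsOpenEmbedding φ ∧
    ContMDiff 𝓘(ℝ, E3) (𝓡 3) ∞ φ ∧
    (∀ y : Kerr.slice a r₁, (ψ y : E4) =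
      E4.ofTimeSpace (bentHeight M a (Kerr.radius a (E4.ofTimeSpace 0 (y : E3)))) (y : E3)) ∧
    (Kerr.smoothMetric M a r₁).IsSpacelikeImmersion 𝓘(ℝ, E3) ψ ∧
    (Kerr.smoothMetric M a r₁).IsFutureUnitNormal 𝓘(ℝ, E3)
      ((Kerr.timeOrientation M a r₁ hM).ofLE le_top) ψ ν ∧
    (∀ y : Kerr.slice a r₁,
      pullbackBilin (I := 𝓡 3) (I' := 𝓘(ℝ, E3)) φ D.h.inner y =
        pullbackBilin (I := 𝓘(ℝ, E4)) (I' := 𝓘(ℝ, E3)) ψ (Kerr.smoothMetric M a r₁).val y) ∧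
    (∀ [(Kerr.smoothMetric M a r₁).HasLeviCivita] (y : Kerr.slice a r₁),
      (pullbackBilin (I := 𝓡 3) (I' := 𝓘(ℝ, E3)) φ D.k y).toLinearMap₁₂ =
        (Kerr.smoothMetric M a r₁).secondFundamentalForm 𝓘(ℝ, E3) ψ ν y)

/-- **The tapered temporal collar** `W = {x | 0 < x⁰ − T(r x) + (r x − r₁)/4}` of the Kerr chart
`Kerr.region a r₁` (10054's line `tapered-temporal-collar`, S1): one-sided to the future (it contains the
whole future `{x⁰ ≥ T(r)}` of the bent leaf), with a past collar of thickness `(r − r₁)/4` pinching at the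
inner edge — the set of which the bent leaf is a Cauchy hypersurface. -/
def taperedCollar (M a r₁ : ℝ) : Set (Kerr.region a r₁) :=
  {x | 0 < (x : E4) 0 - bentHeight M a (Kerr.radius a (x : E4)) + (Kerr.radius a (x : E4) - r₁) / 4}

variable {X}

/-- **Realisation of a development of the exterior sub-datum inside exact Kerr (v2).** `𝒦` is a vacuum
Cauchy development of the pulled-back datum `φ^* D`, and `j : 𝒦 → Kerr.region a r₁` is a smooth,
time-orientation preserving, isometric OPEN EMBEDDING into the exact Kerr chart OVER the bent slice —
`j ∘ ι_𝒦 = ψ`, `dj (ν_𝒦) = ν` — whose range contains the whole tapered collar.  (Intended witness: `𝒦` =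
the tapered collar with the restricted Kerr metric, `j` = the inclusion.) -/
def IsKerrCollarRealisation [Kerr.Facts] {D : InitialDataSet (𝓡 3) X} (M a r₁ : ℝ) (hM : 0 ≤ M)
    (φ : Kerr.slice a r₁ → X) (ψ : Kerr.slice a r₁ → Kerr.region a r₁)
    (ν : NormalField 𝓘(ℝ, E4) ψ) (hΦ : ContMDiff (𝓡 3) (𝓡 3) (∞ + 1) φ)
    (hΦ' : ∀ u, Function.Injective (mfderiv (𝓡 3) (𝓡 3) φ u))
    (𝒦 : VacuumCauchyDevelopment (D.comap φ hΦ hΦ')) (j : 𝒦.carrier → Kerr.region a r₁) : Prop :=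
  ContMDiff (𝓡 4) 𝓘(ℝ, E4) ∞ j ∧ Topology.IsOpenEmbedding j ∧
    𝒦.metric.IsIsometricImmersion (Kerr.smoothMetric M a r₁).toPseudoRiemannianMetric j ∧
    𝒦.timeOrientation.PreservesTimeOrientation j ((Kerr.timeOrientation M a r₁ hM).ofLE le_top) ∧
    j ∘ 𝒦.embed = ψ ∧
    (∀ y : Kerr.slice a r₁, mfderiv (𝓡 4) 𝓘(ℝ, E4) j (𝒦.embed y) (𝒦.normal y) = ν y) ∧
    taperedCollar M a r₁ ⊆ Set.range j

end Vocabulary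

/-! ## The seven stub STATEMENTS (`Sig.stub_<name>`; registered obligations = the `theorem stub_<name>`) -/

/-- **Stub T — `stub_scriTransfer` (THE LEVER; generic; RELATIVE form; size M).**  Let `𝒟` be a Cauchy
development of `D` on `X`, `Φ : N → X` a smooth open embedding with injective differentials, `𝒮` ANY
data embedding of `Φ^* D` which embeds into `𝒟` OVER `Φ` (`χ` smooth, open embedding, isometric,
time-orientation preserving, `χ ∘ ι' = ι ∘ Φ`), `K ⊆ X` compact with `Kᶜ ⊆ range Φ`.  If `𝒮` has
complete future null infinity RELATIVE TO COMPACT SETS OF `X` — some compact `K₀ ⊆ X` such that for every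
`s > 0` some compact `K₁ ⊆ X` such that every normalised null ray of `𝒮` from a point `p` with
`Φ p ∉ K₁` is future complete or sojourns `≥ s` in `J⁺_𝒮(ι'(Φ⁻¹ K₀))` — then `𝒟` has complete future
null infinity from all origins.  Proof plan: a maximal normalised `𝒟`-ray `γ` from `ι(Φ p)` restricts, on
the connected component of `γ⁻¹(range χ)` containing `0`, to `χ ∘ γ'` with `γ'` a MAXIMAL `𝒮`-ray from
`ι' p` (geodesics correspond under the isometric open embedding `χ` — pattern
`Literature.Geometry.Riemannian.SimpleAH.isGeodesicOn_comp` / `exists_geodesic_lift`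
(`AHConvexNearInfinity.lean`) via `PseudoRiemannianMetric.comap`, `restrict_eq_comap`; uniqueness
`IsGeodesicOn.eqOn_of_velocity_eq_holds`; patching contradicts maximality of `γ`), still normalised
(`Theorems.SubdataDevelopmentsEmbed.mfderiv_normal_rel`); `¬BddAbove dom' → ¬BddAbove dom`;
`χ(J⁺_𝒮(S)) ⊆ J⁺_𝒟(χ S)` (`LorentzianMetric.image_causalFuture_subset`, ConvergenceTransport.lean) and
`sojournTime_mono(_left)`; bookkeeping `B₀ := K₀`, `B₁ := K ∪ K₁`. -/
def Sig.stub_scriTransfer : Prop :=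
  ∀ (X : Type) [TopologicalSpace X] [ChartedSpace E3 X] [IsManifold (𝓡 3) ∞ X]
    [T2Space X] [SecondCountableTopology X] [ConnectedSpace X]
    (D : InitialDataSet (𝓡 3) X) (𝒟 : CauchyDevelopment D)
    (N : Type) [TopologicalSpace N] [ChartedSpace E3 N] [IsManifold (𝓡 3) ∞ N] [ConnectedSpace N]
    (Φ : N → X) (hΦ : ContMDiff (𝓡 3) (𝓡 3) (∞ + 1) Φ)
    (hΦ' : ∀ u, Function.Injective (mfderiv (𝓡 3) (𝓡 3) Φ u)),
    Topology.IsOpenEmbedding Φ →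
    ∀ (𝒮 : DataEmbedding (D.comap Φ hΦ hΦ')) (χ : 𝒮.carrier → 𝒟.carrier),
      ContMDiff (𝓡 4) (𝓡 4) ∞ χ → Topology.IsOpenEmbedding χ →
      𝒮.metric.IsIsometricImmersion 𝒟.metric.toPseudoRiemannianMetric χ →
      𝒮.timeOrientation.PreservesTimeOrientation χ 𝒟.timeOrientation →
      χ ∘ 𝒮.embed = 𝒟.embed ∘ Φ →
      ∀ (K : Set X), IsCompact K → Kᶜ ⊆ Set.range Φ →
      (∀ [𝒮.metric.HasLeviCivita],
        ∃ K₀ : Set X, IsCompact K₀ ∧ ∀ s : ℝ, 0 < s → ∃ K₁ : Set X, IsCompact K₁ ∧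
          ∀ p : N, Φ p ∉ K₁ → ∀ (γ : ℝ → 𝒮.carrier) (dom : Set ℝ),
            𝒮.metric.IsNormalisedNullRayFrom 𝒮.timeOrientation 𝒮.embed 𝒮.normal p γ dom →
            ¬ BddAbove dom ∨ ENNReal.ofReal s ≤ sojournTime γ dom
              (𝒮.metric.causalFuture 𝒮.timeOrientation (𝒮.embed '' (Φ ⁻¹' K₀)))) →
      Summit.FinalStateConjecture.HasCompleteNullInfinity 𝒟

/-- **Stub V — `stub_kerrVacuum` (the tree's UNPROVED named fact `Kerr.isRicciFlat`, under
sub-extremality; 10054's S2 is the same fact for all parameters; `a = 0` is the tree theorem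
`Kerr.isRicciFlat_zero_spin`).**  Kerr 1963; Kerr–Schild 1965 §3; O'Neill 1995 Thm. 2.6.1. -/
def Sig.stub_kerrVacuum : Prop :=
  ∀ [Kerr.Facts] (M a r₀ : ℝ), Kerr.IsSubextremal M a → Kerr.isRicciFlat M a r₀

/-- **Stub C — `stub_collarCauchy` (VERBATIM 10054 `tapered-temporal-collar` S1; size M–L; shared).**  The
bent leaf `{x⁰ = T(r)}` is met EXACTLY ONCE by every future-timelike curve of the Kerr chart lying in the
tapered collar `W` and having no endpoint in `W`.  Proof plan there: `u = x⁰ − T(r)` and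
`w = u + (r − r₁)/4` increase along future timelike curves; `≤ 1` crossing by monotonicity; existence by
the escape trichotomy (speed limit `|ẋ⃗| ≤ ṫ*`, hole clock `dr(v) < 0` on `r₋ < r < r₊`, taper at the
inner edge, `T ≤ 2.2 M log(r/M) + C`). -/
def Sig.stub_collarCauchy : Prop :=
  ∀ [Kerr.Facts] (M a r₁ : ℝ) (hM : 0 ≤ M), |a| < M →
    Kerr.rMinus M a < r₁ → r₁ < Kerr.rPlus M a →
    ∀ (γ : ℝ → Kerr.region a r₁) (s : Set ℝ), s.OrdConnected → s.Nonempty →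
      (Kerr.smoothMetric M a r₁).IsFutureTimelikeCurveOn
          ((Kerr.timeOrientation M a r₁ hM).ofLE le_top) γ s →
      (∀ t ∈ s, 0 < (γ t : E4) 0 - bentHeight M a (Kerr.radius a (γ t : E4)) +
          (Kerr.radius a (γ t : E4) - r₁) / 4) →
      (∀ q : Kerr.region a r₁, 0 < (q : E4) 0 - bentHeight M a (Kerr.radius a (q : E4)) +
          (Kerr.radius a (q : E4) - r₁) / 4 →
            ¬ HasFutureEndpoint γ s q ∧ ¬ HasPastEndpoint γ s q) →
      ∃! t, t ∈ s ∧ (γ t : E4) 0 = bentHeight M a (Kerr.radius a (γ t : E4))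

/-- **Stub R — `stub_collarRealisation` (plumbing adapter; size M–L).**  For a shielded datum, granted the
collar Cauchy property (Stub C's conclusion at `(M, a, r₁)`) and Ricci-flatness of the chart (Stub V): the
shield chart `φ` is `C^{∞+1}` with injective differentials (`φ^* h = ψ^* g` is positive definite), and the
pulled-back datum `φ^* D` has a vacuum Cauchy development REALISED in exact Kerr over the bent slice with
the tapered collar in its range (`IsKerrCollarRealisation`).  Intended: the data embedding
`(Kerr.spacetime M a r₁ hM, ψ, ν)` of `φ^*D` (fields from the shield clauses via `comap_h_inner`,
`comap_k`; `ψ` a smooth embedding as the graph of the `C^∞` height, cf. `contDiff_bentHeight` in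
`Theorems/SwallowTheDatumKerrShieldedDataExistStubSliceClause.lean`), restricted to the open connected
`taperedCollar ⊇ range ψ` (`DataEmbedding.restrict`, `CauchyDevelopmentRestrict.lean`), Cauchy by the
hypothesis read through `isFutureTimelikeCurveOn_restrict_iff` / `hasFutureEndpoint_subtypeVal_comp_iff`
(`OpensCausality.lean`), vacuum by `isRicciFlat_restrict`-style transport of `Kerr.isRicciFlat`; `j :=`
`Subtype.val`. -/
def Sig.stub_collarRealisation : Prop :=
  ∀ [Kerr.Facts] (X : Type) [TopologicalSpace X] [ChartedSpace E3 X] [IsManifold (𝓡 3) ∞ X]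
    [T2Space X] [SecondCountableTopology X] [ConnectedSpace X] (D : InitialDataSet (𝓡 3) X)
    (M a r₁ : ℝ) (hM : 0 ≤ M) (φ : Kerr.slice a r₁ → X)
    (ψ : Kerr.slice a r₁ → Kerr.region a r₁) (ν : NormalField 𝓘(ℝ, E4) ψ),
    IsKerrShieldedBy X D M a r₁ hM φ ψ ν →
    (∀ (γ : ℝ → Kerr.region a r₁) (s : Set ℝ), s.OrdConnected → s.Nonempty →
      (Kerr.smoothMetric M a r₁).IsFutureTimelikeCurveOn
          ((Kerr.timeOrientation M a r₁ hM).ofLE le_top) γ s →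
      (∀ t ∈ s, 0 < (γ t : E4) 0 - bentHeight M a (Kerr.radius a (γ t : E4)) +
          (Kerr.radius a (γ t : E4) - r₁) / 4) →
      (∀ q : Kerr.region a r₁, 0 < (q : E4) 0 - bentHeight M a (Kerr.radius a (q : E4)) +
          (Kerr.radius a (q : E4) - r₁) / 4 →
            ¬ HasFutureEndpoint γ s q ∧ ¬ HasPastEndpoint γ s q) →
      ∃! t, t ∈ s ∧ (γ t : E4) 0 = bentHeight M a (Kerr.radius a (γ t : E4))) →
    Kerr.isRicciFlat M a r₁ →
      ∃ (hΦ : ContMDiff (𝓡 3) (𝓡 3) (∞ + 1) φ)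
        (hΦ' : ∀ u, Function.Injective (mfderiv (𝓡 3) (𝓡 3) φ u))
        (𝒦 : VacuumCauchyDevelopment (D.comap φ hΦ hΦ')) (j : 𝒦.carrier → Kerr.region a r₁),
        IsKerrCollarRealisation M a r₁ hM φ ψ ν hΦ hΦ' 𝒦 j

/-- **Stub O — `stub_kerrLeafSojourn` (VERBATIM 10054 `tapered-temporal-collar` S4; size L; HARDEST; shared;
held by the lead).**  Sojourn completeness of the Kerr chart seen from the bent leaf: there is `R₀` such
that for every `s > 0` there is `R₁` such that every normalised future null ray of `g_{M,a}` (maximal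
geodesic in the chart from `ψ y`, `g(γ′0, ν y) = −1`) from a leaf point of radius `≥ R₁` is either future
complete in the chart (`[0, ∞) ⊆ dom`) or sojourns `≥ s` in `J⁺(ψ{r ≤ R₀})`.  Engine: outer cone
`|ẋ⃗| ≤ ṫ*`, conserved Killing energy `E = −g(γ′, ∂_{t*})` (`OpensChart.hasDerivAt_momentum_of_isGeodesicOn`,
`Kerr.isKillingField_stationaryField_holds`), pinch `(1 − 4H)ṫ* ≤ E ≤ ṫ*`, entry radius
`≥ (R_p + R₀)/2 − 1.1 M log R_p − C`, banked affine time `≥ (r_entry − r₊)/(C(M,a)E)`, escape lemma. -/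
def Sig.stub_kerrLeafSojourn : Prop :=
  ∀ [Kerr.Facts] (M a r₁ : ℝ) (hM : 0 ≤ M), |a| < M →
    Kerr.rMinus M a < r₁ → r₁ < Kerr.rPlus M a →
    ∀ (ψ : Kerr.slice a r₁ → Kerr.region a r₁) (ν : NormalField 𝓘(ℝ, E4) ψ),
    (∀ y : Kerr.slice a r₁, (ψ y : E4) =
        E4.ofTimeSpace (bentHeight M a (Kerr.radius a (E4.ofTimeSpace 0 (y : E3)))) (y : E3)) →
    (Kerr.smoothMetric M a r₁).IsFutureUnitNormal 𝓘(ℝ, E3)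
        ((Kerr.timeOrientation M a r₁ hM).ofLE le_top) ψ ν →
    ∀ [(Kerr.smoothMetric M a r₁).HasLeviCivita],
    ∃ R₀ : ℝ, ∀ s : ℝ, 0 < s → ∃ R₁ : ℝ, ∀ y : Kerr.slice a r₁,
      R₁ ≤ Kerr.radius a (E4.ofTimeSpace 0 (y : E3)) →
      ∀ (γ : ℝ → Kerr.region a r₁) (dom : Set ℝ),
        (Kerr.smoothMetric M a r₁).IsNormalisedNullRayFrom
            ((Kerr.timeOrientation M a r₁ hM).ofLE le_top) ψ ν y γ dom →
        Set.Ici (0 : ℝ) ⊆ dom ∨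
          ENNReal.ofReal s ≤ sojournTime γ dom
            ((Kerr.smoothMetric M a r₁).causalFuture ((Kerr.timeOrientation M a r₁ hM).ofLE le_top)
              (ψ '' {y' : Kerr.slice a r₁ | Kerr.radius a (E4.ofTimeSpace 0 (y' : E3)) ≤ R₀}))

/-- **Stub F — `stub_farSojournTransfer` (plumbing adapter; size M–L).**  For a realisation `(𝒦, j)` of the
exterior sub-datum of a shielded datum and granted the chart optics (Stub O's conclusion at
`(M, a, r₁, ψ, ν)`), `𝒦` has complete future null infinity in the sojourn form AS SEEN FROM the far leaf
origins `{R₁ ≤ r}`, with reference set `ι_𝒦{r ≤ R₀}` (radius form; the sets need not be compact in the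
slice — compactness is produced in `X` by `stub_shieldCocompact`).  Proof plan: a maximal normalised
`𝒦`-ray `γ` from `ι_𝒦 y` pushes forward to the chart geodesic `j ∘ γ` with data `(ψ y, L)`,
`g(L, ν y) = −1` (`dj ν_𝒦 = ν`, `j` isometric); the maximal chart ray `γ_K` with that data satisfies Stub
O; `γ_K([0, ∞) ∩ dom_K) ⊆ {u ≥ 0} ⊆ taperedCollar ⊆ range j` because `u = x⁰ − T(r)` increases along
future causal curves of the chart (conormal `dt* − T′dr` past-timelike:
`Negative.conormalForm_bentSlope_neg` + co-orientation `n(V) > 0`), so by maximality of `γ` in `𝒦` the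
component through `0` of `γ_K⁻¹(range j)` lies in `dom` and `γ = j⁻¹ ∘ γ_K` there; `[0, ∞) ⊆ dom_K ⇒
¬ BddAbove dom`; `j⁻¹(J⁺_chart(ψ S) ∩ {u ≥ 0}) ⊆ J⁺_𝒦(ι_𝒦 S)` for causal curves staying in `{u ≥ 0}`
(push through `j⁻¹` on `range j`), `sojournTime` monotone. -/
def Sig.stub_farSojournTransfer : Prop :=
  ∀ [Kerr.Facts] (X : Type) [TopologicalSpace X] [ChartedSpace E3 X] [IsManifold (𝓡 3) ∞ X]
    [T2Space X] [SecondCountableTopology X] [ConnectedSpace X] (D : InitialDataSet (𝓡 3) X)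
    (M a r₁ : ℝ) (hM : 0 ≤ M) (φ : Kerr.slice a r₁ → X)
    (ψ : Kerr.slice a r₁ → Kerr.region a r₁) (ν : NormalField 𝓘(ℝ, E4) ψ),
    IsKerrShieldedBy X D M a r₁ hM φ ψ ν →
    ∀ (hΦ : ContMDiff (𝓡 3) (𝓡 3) (∞ + 1) φ)
      (hΦ' : ∀ u, Function.Injective (mfderiv (𝓡 3) (𝓡 3) φ u))
      (𝒦 : VacuumCauchyDevelopment (D.comap φ hΦ hΦ')) (j : 𝒦.carrier → Kerr.region a r₁),
      IsKerrCollarRealisation M a r₁ hM φ ψ ν hΦ hΦ' 𝒦 j →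
      (∀ [(Kerr.smoothMetric M a r₁).HasLeviCivita],
        ∃ R₀ : ℝ, ∀ s : ℝ, 0 < s → ∃ R₁ : ℝ, ∀ y : Kerr.slice a r₁,
          R₁ ≤ Kerr.radius a (E4.ofTimeSpace 0 (y : E3)) →
          ∀ (γ : ℝ → Kerr.region a r₁) (dom : Set ℝ),
            (Kerr.smoothMetric M a r₁).IsNormalisedNullRayFrom
                ((Kerr.timeOrientation M a r₁ hM).ofLE le_top) ψ ν y γ dom →
            Set.Ici (0 : ℝ) ⊆ dom ∨
              ENNReal.ofReal s ≤ sojournTime γ dom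
                ((Kerr.smoothMetric M a r₁).causalFuture ((Kerr.timeOrientation M a r₁ hM).ofLE le_top)
                  (ψ '' {y' : Kerr.slice a r₁ | Kerr.radius a (E4.ofTimeSpace 0 (y' : E3)) ≤ R₀}))) →
      ∀ [𝒦.metric.HasLeviCivita],
        ∃ R₀ : ℝ, ∀ s : ℝ, 0 < s → ∃ R₁ : ℝ, ∀ y : Kerr.slice a r₁,
          R₁ ≤ Kerr.radius a (E4.ofTimeSpace 0 (y : E3)) →
          ∀ (γ : ℝ → 𝒦.carrier) (dom : Set ℝ),
            𝒦.metric.IsNormalisedNullRayFrom 𝒦.timeOrientation 𝒦.embed 𝒦.normal y γ dom →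
            ¬ BddAbove dom ∨ ENNReal.ofReal s ≤ sojournTime γ dom
              (𝒦.metric.causalFuture 𝒦.timeOrientation
                (𝒦.embed '' {y' : Kerr.slice a r₁ | Kerr.radius a (E4.ofTimeSpace 0 (y' : E3)) ≤ R₀}))

/-- **Stub K — `stub_shieldCocompact` (size M; Riemannian/topological, on the data manifold; radius form).**
For an ADMISSIBLE (complete, one sole asymptotically flat end) Kerr-shielded datum on `X`, every far shield
region `φ {R ≤ r}` is CO-COMPACT in `X`.  This is where completeness / sole-endedness of the member is
load-bearing (on the coreless carrier `X = Kerr.slice a r₁`, `φ = id`, it FAILS).  Proof plan: `X = C ⊔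
φ(slice)`, `C = (range φ)ᶜ` compact; the inner-edge end `{r → r₁⁺}` of the cylinder `φ(slice)` is
relatively compact in `X` because `(X, h)` is geodesically complete and `φ` is a Riemannian isometry onto
its open range for the Kerr–Schild slice metric, whose radial curves reach the inner edge with finite
length (so their `φ`-images converge in `X`, necessarily to points of `C`), while the sole AF end
(`AFEnd.IsSoleEnd`: some `(e.far R')ᶜ` compact) is the `r → ∞` end; `K := C ∪ φ{r ≤ R}` is then
contained in a compact set. -/
def Sig.stub_shieldCocompact : Prop :=
  ∀ [Kerr.Facts] (X : Type) [TopologicalSpace X] [ChartedSpace E3 X] [IsManifold (𝓡 3) ∞ X]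
    [T2Space X] [SecondCountableTopology X] [ConnectedSpace X] (D : InitialDataSet (𝓡 3) X),
    D ∈ admissibleVacuumData X →
    ∀ (M a r₁ : ℝ) (hM : 0 ≤ M) (φ : Kerr.slice a r₁ → X)
      (ψ : Kerr.slice a r₁ → Kerr.region a r₁) (ν : NormalField 𝓘(ℝ, E4) ψ),
      IsKerrShieldedBy X D M a r₁ hM φ ψ ν →
      ∀ R : ℝ, ∃ K : Set X, IsCompact K ∧
        Kᶜ ⊆ φ '' {y : Kerr.slice a r₁ | R ≤ Kerr.radius a (E4.ofTimeSpace 0 (y : E3))}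

/-! ## The registered stubs (`sorry` lives only in these seven theorems) -/

/-- **STUB T** (THE LEVER): relative far-origin completeness ascends along an embedding over a sub-datum. -/
theorem stub_scriTransfer : Sig.stub_scriTransfer := by
  sorry

/-- **STUB V**: the Kerr–Schild metric is Ricci-flat for sub-extremal parameters (named fact). -/
theorem stub_kerrVacuum : Sig.stub_kerrVacuum := by
  sorry

/-- **STUB C** (= 10054 S1): the bent leaf is a Cauchy hypersurface of the tapered collar. -/
theorem stub_collarCauchy : Sig.stub_collarCauchy := by
  sorry

/-- **STUB R**: the tapered collar is a vacuum Cauchy development of the exterior sub-datum, realised in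
exact Kerr with the collar in its range. -/
theorem stub_collarRealisation : Sig.stub_collarRealisation := by
  sorry

/-- **STUB O** (= 10054 S4; HARDEST): sojourn optics of the Kerr chart from the bent leaf. -/
theorem stub_kerrLeafSojourn : Sig.stub_kerrLeafSojourn := by
  sorry

/-- **STUB F**: far-origin sojourn completeness of the realised development from the chart optics. -/
theorem stub_farSojournTransfer : Sig.stub_farSojournTransfer := by
  sorry

/-- **STUB K**: far shield regions of an admissible Kerr-shielded datum are co-compact in `X`. -/
theorem stub_shieldCocompact : Sig.stub_shieldCocompact := by
  sorry

/-! ## Checked against the landed Negative lemmas of this crux -/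
example :
    Summit.FinalStateConjecture.FinalStateConjecture.Theorems.WeakCosmicCensorshipMGHD.Negative.truncated.toCauchyDevelopment.EmbedsInto
        Minkowski.vacuumCauchyDevelopment.toCauchyDevelopment ∧
      ¬ Summit.FinalStateConjecture.HasCompleteNullInfinity
        Summit.FinalStateConjecture.FinalStateConjecture.Theorems.WeakCosmicCensorshipMGHD.Negative.truncated.toCauchyDevelopment :=
  ⟨Summit.FinalStateConjecture.FinalStateConjecture.Theorems.WeakCosmicCensorshipMGHD.Negative.truncated_embedsInto,
    Summit.FinalStateConjecture.FinalStateConjecture.Theorems.WeakCosmicCensorshipMGHD.Negative.not_hasCompleteNullInfinity_truncated⟩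

/-! ## The composition: the seven stubs and the three SwallowTheDatum items conclude the crux BY NAME -/

/-- **`WeakCosmicCensorshipMGHD` from the stubs.**  Unfold `IsChristodoulouGeneric … 1`; through an
exceptional admissible `d` pass the burial family `F` of `ParametricKerrBurial` (10052); a member `F c`,
`c ≠ 0`, is admissible, hence has an MGHD (`MGHDExists`, 9937), and is Kerr-shielded with witnesses
`(M, a, r₁, hM, T = bentHeight M a, φ, ψ, ν)`; Stub C + Stub R (fed by Stub V) realise the tapered collar
as a vacuum development `𝒦` of the exterior sub-datum; Stub O + Stub F give its far-origin completeness in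
radius form; Stub K the compact containers in `X`; `SubdataDevelopmentsEmbed` (10053) embeds `𝒦` into the
given maximal `𝒟` over `φ`; Stub T transfers. -/
theorem WeakCosmicCensorshipMGHD_of :
    MGHDExists → SubdataDevelopmentsEmbed → ParametricKerrBurial →
      Sig.stub_scriTransfer → Sig.stub_kerrVacuum → Sig.stub_collarCauchy →
        Sig.stub_collarRealisation → Sig.stub_kerrLeafSojourn → Sig.stub_farSojournTransfer →
          Sig.stub_shieldCocompact → WeakCosmicCensorshipMGHD := by
  intro hM hE hB hT hV hC hR hO hF hK X _ _ _ _ _ _ d hd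
  obtain ⟨F, h1, h2, h3, h4, h5⟩ := hB X d hd.1
  refine ⟨F, h1, h2, h3, h4, fun c hc hmem ↦ hmem.2 ⟨hM X (F c) (h4 c), fun 𝒟 hmax ↦ ?_⟩⟩
  obtain ⟨M, a, r₁, hM₀, T, φ, ψ, ν, ha, hr₁, hr₂, hTdef, hcpt, hopen, hφs, hψ, hsp, hν, hh, hk⟩ :=
    h5 c hc
  subst hTdef
  have hψ' : ∀ y : Kerr.slice a r₁, (ψ y : E4) =
      E4.ofTimeSpace (bentHeight M a (Kerr.radius a (E4.ofTimeSpace 0 (y : E3)))) (y : E3) :=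
    fun y ↦ by rw [bentHeight_eq_literal]; exact hψ y
  have hS' : IsKerrShieldedBy X (F c) M a r₁ hM₀ φ ψ ν :=
    ⟨ha, hr₁, hr₂, hcpt, hopen, hφs, hψ', hsp, hν, hh, hk⟩
  have hsub : Kerr.IsSubextremal M a := ha
  obtain ⟨hΦ, hΦ', 𝒦, j, hreal⟩ :=
    hR X (F c) M a r₁ hM₀ φ ψ ν hS' (hC M a r₁ hM₀ ha hr₁ hr₂) (hV M a r₁ hsub)
  obtain ⟨χ, hχ, hχo, hiso, hτ, hcomm⟩ := hE X (F c) 𝒟 hmax (Kerr.slice a r₁) φ hΦ hΦ' hopen 𝒦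
  -- `HasCompleteNullInfinity` binds the (provable) Levi-Civita instance of `𝒟`; introduce it.
  intro hLC
  refine hT X (F c) 𝒟.toCauchyDevelopment (Kerr.slice a r₁) φ hΦ hΦ' hopen 𝒦.toDataEmbedding
    χ hχ hχo hiso hτ hcomm (Set.range φ)ᶜ hcpt (by rw [compl_compl]) ?_
  intro _instK
  -- far-origin completeness of `𝒦` (Stub F fed by Stub O), read at the bound instance
  obtain ⟨R₀, hR₀⟩ :=
    hF X (F c) M a r₁ hM₀ φ ψ ν hS' hΦ hΦ' 𝒦 j hreal (hO M a r₁ hM₀ ha hr₁ hr₂ ψ ν hψ' hν)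
  obtain ⟨K₀, hK₀c, hK₀⟩ := hK X (F c) (h4 c) M a r₁ hM₀ φ ψ ν hS' (R₀ + 1)
  refine ⟨K₀, hK₀c, fun s hs ↦ ?_⟩
  obtain ⟨R₁, hR₁⟩ := hR₀ s hs
  obtain ⟨K₁, hK₁c, hK₁⟩ := hK X (F c) (h4 c) M a r₁ hM₀ φ ψ ν hS' R₁
  refine ⟨K₁, hK₁c, fun p hp γ dom hγ ↦ ?_⟩
  have hpR : R₁ ≤ Kerr.radius a (E4.ofTimeSpace 0 (p : E3)) := by
    obtain ⟨y', hy', hyp⟩ := hK₁ hp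
    rw [← hopen.injective hyp]
    exact hy'
  rcases hR₁ p hpR γ dom hγ with h | h
  · exact Or.inl h
  · refine Or.inr (h.trans (sojournTime_mono _ _ (LorentzianMetric.causalFuture_mono
      (image_mono fun y' hy' ↦ ?_))))
    -- `{r ≤ R₀} ⊆ φ⁻¹ K₀`: a far shield point outside `K₀` has radius `≥ R₀ + 1`
    by_contra hn
    obtain ⟨y'', hy'', he⟩ := hK₀ hn
    have := hopen.injective he
    subst this
    simp only [Set.mem_setOf_eq] at hy' hy''
    linarith

/-- The skeleton instantiated: the crux from the registered stubs and the three SwallowTheDatum items. -/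
example (hM : MGHDExists) (hE : SubdataDevelopmentsEmbed) (hB : ParametricKerrBurial) :
    WeakCosmicCensorshipMGHD :=
  WeakCosmicCensorshipMGHD_of hM hE hB stub_scriTransfer stub_kerrVacuum stub_collarCauchy
    stub_collarRealisation stub_kerrLeafSojourn stub_farSojournTransfer stub_shieldCocompact

end Summit.FinalStateConjecture.FinalStateConjecture.Cruxes.WeakCosmicCensorshipMGHD.ScriTransferThirdOfBurial

end
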